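import Mathlib

/-!
# B3DenseSubgroup — the «dense subgroup of a product» step of T4-B3 §B4(b.1) and §B3(d.4)

Two steps of sub-claim B3 (pub-hodge-repro2, README §6.1(a)) end with the same argument:
a continuous character of an idèle group `A = A_∞ × A^∞` (archimedean part × finite part) that is
trivial on the finite part (or agrees with another one there) and on a subgroup `Γ` (the principal
idèles `E^×`, resp. `k'^×`) whose projection to the archimedean part is dense (weak approximation,
Cassels Ch. 2 Thm. 3.1) is determined on the whole group — §B4(b.1) («`E^×·(A_E^∞)^×` is dense in
`A_E^×` … so `μ = μ'`») and §B3(d.4) («`ν_0(x) = ν_0(x_S)` … `ν_0 = 1` on `∏_{v∈S} k'_v^×` by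
continuity and hence on `k'_A^×`»).  This file records the topological-group core for an arbitrary
product `H × K` of topological groups:

* `fstSat Γ` — the subgroup `{x : x.1 ∈ Γ.map fst} = Γ·({1} × K)` of `H × K`
  (`mem_fstSat_iff`, `mem_fstSat_of_mem`, `exists_mul_of_mem_fstSat`);
* `dense_fstSat` — if `Γ` has dense first projection, `fstSat Γ` is dense in `H × K`;
* `eq_of_eqOn_of_fst_dense` — two continuous homomorphisms into a Hausdorff group that agree on
  such a `Γ` and on `{1} × K` are equal;
* `eq_one_of_eqOn_of_fst_dense` — the special case `g = 1` used in §B3(d.4).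

The idèle-theoretic inputs (weak approximation, the factorisation of `A_E^×`) stay prose.
-/

namespace Summit.Ventures.HodgeRepro2.ShimuraData.B3DenseSubgroup

variable {H K : Type*} [Group H] [Group K]

/-- The subgroup `{x : x.1 ∈ Γ.map fst}` of `H × K` — the product `Γ·({1} × K)` (T4-B3 §B4(b.1):
`E^×·(A_E^∞)^× = {x ∈ A_E^× : x_∞ ∈ E^×}` inside `A_E^× = E_∞^× × (A_E^∞)^×`). -/
def fstSat (Γ : Subgroup (H × K)) : Subgroup (H × K) :=
  (Γ.map (MonoidHom.fst H K)).prod ⊤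

/-- Membership in `fstSat Γ`. -/
theorem mem_fstSat_iff (Γ : Subgroup (H × K)) (x : H × K) :
    x ∈ fstSat Γ ↔ x.1 ∈ Γ.map (MonoidHom.fst H K) := by
  simp [fstSat, Subgroup.mem_prod]

/-- `Γ ≤ fstSat Γ`. -/
theorem mem_fstSat_of_mem (Γ : Subgroup (H × K)) {x : H × K} (hx : x ∈ Γ) : x ∈ fstSat Γ :=
  (mem_fstSat_iff Γ x).2 ⟨x, hx, rfl⟩

/-- `{1} × K ≤ fstSat Γ`. -/
theorem one_mem_fstSat (Γ : Subgroup (H × K)) (k : K) : ((1 : H), k) ∈ fstSat Γ :=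
  (mem_fstSat_iff Γ _).2 (Subgroup.one_mem _)

/-- Every element of `fstSat Γ` is `γ * (1, k)` with `γ ∈ Γ`. -/
theorem exists_mul_of_mem_fstSat (Γ : Subgroup (H × K)) {x : H × K} (hx : x ∈ fstSat Γ) :
    ∃ γ ∈ Γ, ∃ k : K, x = γ * ((1 : H), k) := by
  obtain ⟨γ, hγ, hγx⟩ := (mem_fstSat_iff Γ x).1 hx
  refine ⟨γ, hγ, γ.2⁻¹ * x.2, ?_⟩
  ext
  · simp only [Prod.fst_mul, mul_one]
    exact hγx.symm
  · simp

section Topology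

variable [TopologicalSpace H] [TopologicalSpace K]

/-- If the first projection of `Γ ≤ H × K` is dense in `H`, then `fstSat Γ = Γ·({1} × K)` is
dense in `H × K` (T4-B3 §B4(b.1): weak approximation makes `E^×` dense in `E_∞^×`, hence
`E^×·(A_E^∞)^×` dense in `A_E^×`). -/
theorem dense_fstSat (Γ : Subgroup (H × K))
    (hΓ : Dense ((Γ.map (MonoidHom.fst H K) : Subgroup H) : Set H)) :
    Dense ((fstSat Γ : Subgroup (H × K)) : Set (H × K)) := by
  have e : ((fstSat Γ : Subgroup (H × K)) : Set (H × K)) =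
      ((Γ.map (MonoidHom.fst H K) : Subgroup H) : Set H) ×ˢ (Set.univ : Set K) := by
    ext x
    simp only [SetLike.mem_coe, Set.mem_prod, Set.mem_univ, and_true]
    exact mem_fstSat_iff Γ x
  rw [e]
  exact hΓ.prod dense_univ

variable {M : Type*} [Group M] [TopologicalSpace M] [T2Space M]

/-- Two continuous homomorphisms `H × K →* M` (`M` Hausdorff) that agree on `{1} × K` and on a
subgroup `Γ` with dense first projection are equal (T4-B3 §B4(b.1): `μ'μ⁻¹` trivial on
`(A_E^∞)^×` and on `E^×` forces `μ = μ'`). -/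
theorem eq_of_eqOn_of_fst_dense {f g : H × K →* M} (hf : Continuous f) (hg : Continuous g)
    (Γ : Subgroup (H × K)) (hΓ : Dense ((Γ.map (MonoidHom.fst H K) : Subgroup H) : Set H))
    (hΓfg : ∀ x ∈ Γ, f x = g x) (hK : ∀ k : K, f (1, k) = g (1, k)) : f = g := by
  have hsat : ∀ x ∈ fstSat Γ, f x = g x := by
    intro x hx
    obtain ⟨γ, hγ, k, rfl⟩ := exists_mul_of_mem_fstSat Γ hx
    rw [map_mul, map_mul, hΓfg γ hγ, hK k]
  exact DFunLike.coe_injective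
    (Continuous.ext_on (dense_fstSat Γ hΓ) hf hg fun x hx => hsat x hx)

/-- The special case `g = 1` (T4-B3 §B3(d.4): a continuous character trivial on the idèles
supported outside `S` and on the principal idèles is trivial). -/
theorem eq_one_of_eqOn_of_fst_dense {f : H × K →* M} (hf : Continuous f)
    (Γ : Subgroup (H × K)) (hΓ : Dense ((Γ.map (MonoidHom.fst H K) : Subgroup H) : Set H))
    (hΓf : ∀ x ∈ Γ, f x = 1) (hK : ∀ k : K, f (1, k) = 1) : f = 1 :=
  eq_of_eqOn_of_fst_dense hf continuous_const Γ hΓ (fun x hx => hΓf x hx) (fun k => hK k)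

end Topology

end Summit.Ventures.HodgeRepro2.ShimuraData.B3DenseSubgroup
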